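import Literature.NumberTheory.LFunctions.LevinsonMeanSquareOffDiagonal
import Literature.NumberTheory.LFunctions.BCHDiagonalReindex
import HarnessLib

/-!
# The BCH mean square, diagonal half: `∫_T^{2T} |A(½+it) Σ_{n ≤ √(t/2π)} n^{-1/2-it}|² dt`
# is its diagonal up to `O(N√T · B² log⁵ T)`

Topic `Literature/NumberTheory/LFunctions`. Everything in this file is PROVED (no definitions, no
named facts).

For `A(s) = Σ_{h ≤ N} a_h h^{-s}` with `|a_h| ≤ B` and the approximate functional equation sum
`S_t = Σ_{n ≤ ⌊√(t/2π)⌋} n^{-(½+it)}` of `t`-dependent length (the `z`-part of `Z = z + z̄ + O(t^{-1/4})`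
on the critical line), the mean square `∫_T^{2T} |A(½+it) S_t|² dt` is the first half of the
Balasubramanian–Conrey–Heath-Brown mean square (named fact
`Literature.Barriers.RiemannHypothesis.BalasubramanianConreyHeathBrown1985_meanSquare`; plan in the
docstring of `Literature/NumberTheory/LFunctions/BCHDiagonalReindex.lean`). This file instantiates the
tree's activated mean value theorem
`Literature.NumberTheory.LFunctions.LevinsonMS.norm_weighted_meanSquare_mul_sub_diag_le` (Levinson 1974
§4 / Titchmarsh §7.4) with `β = a`, `α ≡ 1`, `a = ½`, `w ≡ 1` on `[T, 2T]` and rewrites its diagonal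
in the index convention `i = (n, h)` of `BCHDiagonalReindex.lean`:

* `BCH.sum_filter_mul_swap` — the coincidence double sum is invariant under `(h, n) ↦ (n, h)`;
* `BCH.levinsonCoeff_swap_eq_diagCoeff` — the coefficient `a_h · 1 · (hn)^{-1/2}` of the activated
  product is `BCH.diagCoeff a (n, h)`;
* `BCH.norm_meanSquare_sub_rawDiag_le` — **the diagonal half, raw form**: with
  `N' = ⌊√(2T/2π)⌋`, `M = N N'`,
  `‖∫_T^{2T} |A(½+it) S_t|² dt − Σ_{i ∈ [1,N']×[1,N]} Σ_{j, μ_j = μ_i} x_i x̄_j ∫_T^{2T}[2πn² ≤ t][2πn'² ≤ t] dt‖`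
  `  ≤ 4 M (1 + log M) · B² (1 + log N')(1 + log N)³`
  (`x_{(n,h)} = a_h (nh)^{-1/2}`, `μ_{(n,h)} = nh`). The closed form of the diagonal
  (`BCH.sum_coincidence_diag_eq`) and its asymptotic evaluation (`BCHDiagonalSum.lean`) turn this into
  `T Σ_{h,k} a_h ā_k/[h,k] (½ log(T/(2πM_{hk}²)) + γ + log 2 − ½) + O(B²N² log N + B² N√T log⁵ T)` in the
  sibling file `BCHDiagonalMeanSquare.lean`.

## References

* [Levinson1974] N. Levinson, Adv. Math. 13 (1974), 383–436, §4 (mean square of the mollified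
  approximate functional equation; only the diagonal `kn = k'n'` contributes to the constant).
* [Titchmarsh1986] E. C. Titchmarsh, *The Theory of the Riemann Zeta-Function*, 2nd ed. (1986), §7.4.
-/

noncomputable section

open Finset Real MeasureTheory Complex Set intervalIntegral
open scoped ComplexConjugate

namespace Literature.NumberTheory.LFunctions.BCH

/-! ### Swapping the index convention `(h, n) ↔ (n, h)` -/

/-- The coincidence double sum `Σ_{i ∈ s × t} Σ_{j ∈ s × t, j₁j₂ = i₁i₂} F(i, j)` is unchanged by
swapping the two coordinates throughout. [folklore] -/
theorem sum_filter_mul_swap {α : Type*} [AddCommMonoid α] (s t : Finset ℕ)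
    (F : ℕ × ℕ → ℕ × ℕ → α) :
    ∑ i ∈ s ×ˢ t, ∑ j ∈ (s ×ˢ t).filter (fun j => j.1 * j.2 = i.1 * i.2), F i j =
      ∑ i ∈ t ×ˢ s, ∑ j ∈ (t ×ˢ s).filter (fun j => j.1 * j.2 = i.1 * i.2), F i.swap j.swap := by
  refine Finset.sum_equiv (Equiv.prodComm ℕ ℕ) (fun i => ?_) (fun i _ => ?_)
  · simp only [Equiv.prodComm_apply, Finset.mem_product, Prod.fst_swap, Prod.snd_swap]
    exact and_comm
  · simp only [Equiv.prodComm_apply, Prod.swap_swap]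
    refine Finset.sum_equiv (Equiv.prodComm ℕ ℕ) (fun j => ?_) (fun j _ => ?_)
    · simp only [Equiv.prodComm_apply, Finset.mem_filter, Finset.mem_product, Prod.fst_swap,
        Prod.snd_swap]
      rw [mul_comm j.2 j.1, mul_comm i.2 i.1]
      exact ⟨fun h => ⟨⟨h.1.2, h.1.1⟩, h.2⟩, fun h => ⟨⟨h.1.2, h.1.1⟩, h.2⟩⟩
    · simp only [Equiv.prodComm_apply, Prod.swap_swap]

/-! ### The coefficients -/

/-- The coefficient `a_h · (hn)^{-1/2}` of the activated product `A(½+it)·S_t` (the `x_i` of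
`LevinsonMS.norm_weighted_meanSquare_mul_sub_diag_le` with `β = a`, `α ≡ 1`, `a = ½`, after `· 1` is
removed), in the swapped convention, is `BCH.diagCoeff a (n, h)`. [folklore] -/
theorem levinsonCoeff_swap_eq_diagCoeff (a : ℕ → ℂ) (i : ℕ × ℕ) :
    a i.swap.1 * ((((i.swap.1 * i.swap.2 : ℕ) : ℝ) ^ (-(1 / 2 : ℝ)) : ℝ) : ℂ) = diagCoeff a i := by
  obtain ⟨n, h⟩ := i
  simp only [Prod.swap_prod_mk]
  rw [diagCoeff_apply, Nat.mul_comm h n]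

/-! ### The activated mean value theorem for `A · S_t` on `[T, 2T]` -/

/-- **The diagonal half of the BCH mean square, raw form.** For `T ≥ 0`, `|a_h| ≤ B` (`h ≤ N`),
`N' = ⌊√(2T/2π)⌋`, `M = N N'`, `x_{(n,h)} = a_h (nh)^{-1/2}`:
`‖∫_T^{2T} |A(½+it)·Σ_{n ≤ ⌊√(t/2π)⌋} n^{-(½+it)}|² dt`
`   − Σ_{i ∈ [1,N']×[1,N]} Σ_{j, n'k = nh} x_i x̄_j ∫_T^{2T} [2πn² ≤ t][2πn'² ≤ t] dt‖`
`  ≤ 2 · 2M(1 + log M) · B² (1 + log N')(1 + log N)³` — Levinson's `I₁₁` bookkeeping for general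
coefficients: the off-diagonal is `O(N√T B² log⁵ T)`, i.e. `o(T)` for `N = T^θ`, `θ < ½`.
[cite: Levinson1974, §4] -/
theorem norm_meanSquare_sub_rawDiag_le (a : ℕ → ℂ) (N : ℕ) {T B : ℝ} (hT : 0 ≤ T)
    (hB : ∀ h ∈ Finset.Icc 1 N, ‖a h‖ ≤ B) :
    ‖((∫ t in T..(2 * T),
          ‖(∑ k ∈ Finset.Icc 1 N, a k * (k : ℂ) ^ (-(((1 / 2 : ℝ) : ℂ) + t * I))) *
            (∑ n ∈ Finset.Icc 1 ⌊Real.sqrt (t / (2 * π))⌋₊,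
              (n : ℂ) ^ (-(((1 / 2 : ℝ) : ℂ) + t * I)))‖ ^ 2 : ℝ) : ℂ) -
        ∑ i ∈ Finset.Icc 1 ⌊Real.sqrt (2 * T / (2 * π))⌋₊ ×ˢ Finset.Icc 1 N,
          ∑ j ∈ (Finset.Icc 1 ⌊Real.sqrt (2 * T / (2 * π))⌋₊ ×ˢ Finset.Icc 1 N) with
              j.1 * j.2 = i.1 * i.2,
            diagCoeff a i * conj (diagCoeff a j) *
              ∫ t in T..(2 * T), (if 2 * π * ((i.1 : ℕ) : ℝ) ^ 2 ≤ t ∧ 2 * π * ((j.1 : ℕ) : ℝ) ^ 2 ≤ t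
                then (((1 : ℝ) : ℝ) : ℂ) else 0)‖ ≤
      2 * (2 * ((N * ⌊Real.sqrt (2 * T / (2 * π))⌋₊ : ℕ) : ℝ) *
          (1 + Real.log ((N * ⌊Real.sqrt (2 * T / (2 * π))⌋₊ : ℕ) : ℝ))) *
        (B ^ 2 * ((1 + Real.log (⌊Real.sqrt (2 * T / (2 * π))⌋₊ : ℕ)) * (1 + Real.log N) ^ 3)) := by
  have hTT' : T ≤ 2 * T := by linarith
  -- the activated mean value theorem with `β = a`, `α ≡ 1`, `a = ½`, `w ≡ 1`
  have hmain := LevinsonMS.norm_weighted_meanSquare_mul_sub_diag_le a (fun _ => (1 : ℂ)) N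
    (a := 1 / 2) (T := T) (T' := 2 * T) (B := B) (C := 1) (W₀ := 1) (W₁ := 0)
    (by norm_num) hT hTT' hB (fun n _ => by simp)
    (w := fun _ => (1 : ℝ)) (w' := fun _ => (0 : ℝ)) (fun t _ => hasDerivAt_const t (1 : ℝ))
    continuousOn_const (fun t _ => by simp) (by simp)
  -- simplify the constants: `(2·1 + 0)`, `C² = 1`, `M^{1 − 2·½} = 1`, and `w = 1`, `α = 1`
  have hM0 : ((N * ⌊Real.sqrt (2 * T / (2 * π))⌋₊ : ℕ) : ℝ) ^ (1 - 2 * (1 / 2 : ℝ)) = 1 := by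
    rw [show (1 : ℝ) - 2 * (1 / 2) = 0 by norm_num, Real.rpow_zero]
  rw [hM0] at hmain
  simp only [one_mul, mul_one, one_pow, add_zero] at hmain
  -- the diagonal: swap the index convention and identify the coefficients
  have hdiag :
      ∑ i ∈ Finset.Icc 1 N ×ˢ Finset.Icc 1 ⌊Real.sqrt (2 * T / (2 * π))⌋₊,
        ∑ j ∈ (Finset.Icc 1 N ×ˢ Finset.Icc 1 ⌊Real.sqrt (2 * T / (2 * π))⌋₊) with
            j.1 * j.2 = i.1 * i.2,
          a i.1 * ((((i.1 * i.2 : ℕ) : ℝ) ^ (-(1 / 2 : ℝ)) : ℝ) : ℂ) *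
            conj (a j.1 * ((((j.1 * j.2 : ℕ) : ℝ) ^ (-(1 / 2 : ℝ)) : ℝ) : ℂ)) *
            ∫ t in T..(2 * T), (if 2 * π * ((i.2 : ℕ) : ℝ) ^ 2 ≤ t ∧ 2 * π * ((j.2 : ℕ) : ℝ) ^ 2 ≤ t
              then (((1 : ℝ)) : ℂ) else 0) =
      ∑ i ∈ Finset.Icc 1 ⌊Real.sqrt (2 * T / (2 * π))⌋₊ ×ˢ Finset.Icc 1 N,
        ∑ j ∈ (Finset.Icc 1 ⌊Real.sqrt (2 * T / (2 * π))⌋₊ ×ˢ Finset.Icc 1 N) with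
            j.1 * j.2 = i.1 * i.2,
          diagCoeff a i * conj (diagCoeff a j) *
            ∫ t in T..(2 * T), (if 2 * π * ((i.1 : ℕ) : ℝ) ^ 2 ≤ t ∧ 2 * π * ((j.1 : ℕ) : ℝ) ^ 2 ≤ t
              then (((1 : ℝ)) : ℂ) else 0) := by
    rw [sum_filter_mul_swap]
    refine Finset.sum_congr rfl fun i _ => Finset.sum_congr rfl fun j _ => ?_
    rw [levinsonCoeff_swap_eq_diagCoeff, levinsonCoeff_swap_eq_diagCoeff]
    simp only [Prod.snd_swap]
    rfl
  rw [hdiag, intervalIntegral.integral_ofReal] at hmain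
  exact hmain

end Literature.NumberTheory.LFunctions.BCH
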